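import Summits.CriticalPhenomena.SAWScalingLimit.Theorems.SAWDefectDecoherenceBoundaryClosureRZigzagHalfLattice
import Summits.CriticalPhenomena.SAWScalingLimit.Theorems.SAWDefectDecoherenceBoundaryClosureRPhaseWedge
import HarnessLib

/-!
# `BoundaryClosureR` (stmt-CriticalPhenomena-14004), line `polygon-parity-squeeze`, stub
# `transportRigidity` (E), part F3: lattice corners as wedges

The corner hypothesis of the identification step (E) describes the domain near a corner `c` as
the intersection (convex corner) or the union (reflex corner) of two zigzag half-planes
`{re((w - c) conj n) > 0}`, `{re((w - c) conj n') > 0}` through `c`, with unit inner normals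
`n' ≠ ±n`.  The landed Schwarz–Christoffel structure `cornerStructure` wants the domain near `c`
as a WEDGE `{z ≠ c, |arg((z - c) e^{-iψ})| < θπ/2}`.  Here we convert:

* `re_mul_exp_mul_I` — `re(w e^{iβ}) = ‖w‖ cos(arg w + β)`;
* `wedge_inter_iff`, `wedge_union_iff` — two half-planes with normals `e^{± iα}` (`0 < α < π/2`)
  meet in the wedge `|arg w| < π/2 - α` and join in the wedge `|arg w| < π/2 + α`;
* `halfPlanes_eq_wedge` — for unit `n' ≠ ±n` with `re(n conj n') ≥ -1/2` (angle `≤ 2π/3`):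
  intersection `=` wedge of opening `θπ`, union `=` wedge of opening `(2-θ)π`, `1/3 ≤ θ < 1`;
* `innerNormal_re_mul_conj` — the six zigzag normals (unit vectors, `norm_innerNormal`) are at
  mutual angles `60°` or `120°` (when not equal or opposite), so the corner openings are
  `θ ∈ {1/3, 2/3}` (convex) and `2 - θ ∈ {4/3, 5/3}` (reflex).
-/

noncomputable section

open scoped ComplexConjugate
open Set Complex

namespace Summit.CriticalPhenomena.SAWScalingLimit.Theorems.PolygonParitySqueeze

namespace Transport

/-! ### 1. Trigonometric bookkeeping -/

/-- `re(w e^{iβ}) = ‖w‖ cos(arg w + β)`. [folklore] -/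
theorem re_mul_exp_mul_I (w : ℂ) (β : ℝ) :
    (w * exp ((β : ℂ) * I)).re = ‖w‖ * Real.cos (arg w + β) := by
  conv_lhs => rw [← norm_mul_exp_arg_mul_I w]
  rw [mul_assoc, ← Complex.exp_add, ← add_mul, ← ofReal_add, re_ofReal_mul, exp_ofReal_mul_I_re]

/-- Two half-planes with unit normals `e^{∓iα}`, `0 < α < π/2`, meet in the wedge
`|arg w| < π/2 - α`. [folklore] -/
theorem wedge_inter_iff {α : ℝ} (hα0 : 0 < α) (hα : α < Real.pi / 2) (w : ℂ) :
    (0 < (w * exp (((-α : ℝ) : ℂ) * I)).re ∧ 0 < (w * exp ((α : ℂ) * I)).re) ↔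
      (w ≠ 0 ∧ |arg w| < Real.pi / 2 - α) := by
  by_cases hw : w = 0
  · simp [hw]
  have hn : 0 < ‖w‖ := norm_pos_iff.2 hw
  rw [re_mul_exp_mul_I, re_mul_exp_mul_I, mul_pos_iff_of_pos_left hn,
    mul_pos_iff_of_pos_left hn]
  have h1 : |arg w + -α| < 3 * Real.pi / 2 := by
    rw [abs_lt]; constructor <;> linarith [neg_pi_lt_arg w, arg_le_pi w]
  have h2 : |arg w + α| < 3 * Real.pi / 2 := by
    rw [abs_lt]; constructor <;> linarith [neg_pi_lt_arg w, arg_le_pi w]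
  rw [PhaseGeometry.cos_pos_iff_abs_lt h1, PhaseGeometry.cos_pos_iff_abs_lt h2, abs_lt, abs_lt, abs_lt]
  simp only [ne_eq, hw, not_false_eq_true, true_and]
  constructor
  · rintro ⟨⟨h3, h4⟩, h5, h6⟩; constructor <;> linarith
  · rintro ⟨h3, h4⟩; refine ⟨⟨?_, ?_⟩, ?_, ?_⟩ <;> linarith

/-- Two half-planes with unit normals `e^{∓iα}`, `0 < α < π/2`, join in the wedge
`|arg w| < π/2 + α`. [folklore] -/
theorem wedge_union_iff {α : ℝ} (hα0 : 0 < α) (hα : α < Real.pi / 2) (w : ℂ) :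
    (0 < (w * exp (((-α : ℝ) : ℂ) * I)).re ∨ 0 < (w * exp ((α : ℂ) * I)).re) ↔
      (w ≠ 0 ∧ |arg w| < Real.pi / 2 + α) := by
  by_cases hw : w = 0
  · simp [hw]
  have hn : 0 < ‖w‖ := norm_pos_iff.2 hw
  rw [re_mul_exp_mul_I, re_mul_exp_mul_I, mul_pos_iff_of_pos_left hn,
    mul_pos_iff_of_pos_left hn]
  have h1 : |arg w + -α| < 3 * Real.pi / 2 := by
    rw [abs_lt]; constructor <;> linarith [neg_pi_lt_arg w, arg_le_pi w]
  have h2 : |arg w + α| < 3 * Real.pi / 2 := by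
    rw [abs_lt]; constructor <;> linarith [neg_pi_lt_arg w, arg_le_pi w]
  rw [PhaseGeometry.cos_pos_iff_abs_lt h1, PhaseGeometry.cos_pos_iff_abs_lt h2, abs_lt, abs_lt, abs_lt]
  simp only [ne_eq, hw, not_false_eq_true, true_and]
  constructor
  · rintro (⟨h3, h4⟩ | ⟨h3, h4⟩) <;> constructor <;> linarith
  · rintro ⟨h3, h4⟩
    rcases le_or_gt 0 (arg w) with h5 | h5
    · left; constructor <;> linarith
    · right; constructor <;> linarith

/-! ### 2. Two half-planes through a point as a wedge -/

/-- **Two zigzag half-planes through `c` form a wedge.**  For unit normals `n' ≠ ± n` at angle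
`≤ 2π/3` (`re(n conj n') ≥ -1/2`), there are a bisector direction `ψ` and an opening parameter
`θ ∈ [1/3, 1)` with
`{re((w-c) conj n) > 0} ∩ {re((w-c) conj n') > 0} = {z ≠ c, |arg((z-c) e^{-iψ})| < θπ/2}` and
`{…} ∪ {…} = {z ≠ c, |arg((z-c) e^{-iψ})| < (2-θ)π/2}`. [folklore] -/
theorem halfPlanes_eq_wedge {n n' : ℂ} (hn : ‖n‖ = 1) (hn' : ‖n'‖ = 1) (hne : n' ≠ n)
    (hne' : n' ≠ -n) (hcos : -(1 / 2 : ℝ) ≤ (n * conj n').re) (c : ℂ) :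
    ∃ ψ θ : ℝ, 1 / 3 ≤ θ ∧ θ < 1 ∧
      {w : ℂ | 0 < ((w - c) * conj n).re} ∩ {w : ℂ | 0 < ((w - c) * conj n').re} =
        {z : ℂ | z ≠ c ∧ |arg ((z - c) * exp (-(ψ : ℂ) * I))| < θ * Real.pi / 2} ∧
      {w : ℂ | 0 < ((w - c) * conj n).re} ∪ {w : ℂ | 0 < ((w - c) * conj n').re} =
        {z : ℂ | z ≠ c ∧ |arg ((z - c) * exp (-(ψ : ℂ) * I))| < (2 - θ) * Real.pi / 2} := by
  have hnn : n * conj n = 1 := by rw [mul_conj, Complex.normSq_eq_norm_sq, hn]; simp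
  have hnn' : n' * conj n' = 1 := by rw [mul_conj, Complex.normSq_eq_norm_sq, hn']; simp
  have hcn' : conj n' * n' = 1 := by rw [mul_comm]; exact hnn'
  -- the relative rotation `u = n conj n'` and its argument `φ₀`
  set u : ℂ := n * conj n' with hu
  have hu1 : ‖u‖ = 1 := by rw [hu, norm_mul, norm_conj, hn, hn', mul_one]
  have hu0 : u ≠ 0 := fun h => by simp [h] at hu1
  have hun : u * n' = n := by rw [hu, mul_assoc, hcn', mul_one]
  have hu_ne1 : u ≠ 1 := fun h => hne (by rw [← hun, h, one_mul])
  have hu_ne_neg1 : u ≠ -1 := fun h => hne' (by rw [← hun, h]; ring)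
  set φ₀ : ℝ := arg u with hφ₀
  have huim : u.im ≠ 0 := PhaseGeometry.im_ne_zero_of_unit hu1 hu_ne1 hu_ne_neg1
  have hφ₀0 : φ₀ ≠ 0 := fun h => by
    rw [hφ₀, arg_eq_zero_iff] at h
    exact huim h.2
  have hφ₀π : φ₀ ≠ Real.pi := fun h => by
    rw [hφ₀, arg_eq_pi_iff] at h
    exact huim h.2
  have habsπ : |φ₀| < Real.pi := by
    refine lt_of_le_of_ne (abs_arg_le_pi u) fun h => ?_
    rcases (abs_eq Real.pi_pos.le).1 h with h' | h'
    · exact hφ₀π h'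
    · linarith [neg_pi_lt_arg u]
  have habs0 : 0 < |φ₀| := abs_pos.2 hφ₀0
  -- `cos φ₀ = re u ≥ -1/2`, so `|φ₀| ≤ 2π/3`
  have hcosφ : Real.cos φ₀ = u.re := by rw [hφ₀, Complex.cos_arg hu0, hu1, div_one]
  have habs23 : |φ₀| ≤ 2 * Real.pi / 3 := by
    by_contra hlt
    push Not at hlt
    have h1 : Real.cos |φ₀| < Real.cos (2 * Real.pi / 3) :=
      Real.cos_lt_cos_of_nonneg_of_le_pi (by positivity) habsπ.le hlt
    have h2 : Real.cos (2 * Real.pi / 3) = -(1 / 2) := by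
      rw [show 2 * Real.pi / 3 = Real.pi - Real.pi / 3 by ring, Real.cos_pi_sub, Real.cos_pi_div_three]
    rw [Real.cos_abs, hcosφ, h2] at h1
    exact absurd hcos (not_le.2 h1)
  -- the half-angle `α`, the opening `θ`, the bisector `b`
  set α : ℝ := |φ₀| / 2 with hα
  have hα0 : 0 < α := by positivity
  have hαπ : α < Real.pi / 2 := by rw [hα]; linarith
  set θ : ℝ := 1 - |φ₀| / Real.pi with hθ
  have hθπ : θ * Real.pi / 2 = Real.pi / 2 - α := by
    rw [hθ, hα]; field_simp
  have hθπ' : (2 - θ) * Real.pi / 2 = Real.pi / 2 + α := by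
    rw [hθ, hα]; field_simp; ring
  set b : ℂ := n' * exp (((φ₀ / 2 : ℝ) : ℂ) * I) with hb
  have hue : u = exp ((φ₀ : ℂ) * I) := by
    have := norm_mul_exp_arg_mul_I u
    rw [hu1, ofReal_one, one_mul] at this
    exact this.symm
  have hb1 : ‖b‖ = 1 := by rw [hb, norm_mul, hn', norm_exp_ofReal_mul_I, mul_one]
  have hbb : conj b * b = 1 := by rw [mul_comm, mul_conj, Complex.normSq_eq_norm_sq, hb1]; simp
  have hconj_exp : ∀ t : ℝ, conj (exp ((t : ℂ) * I)) = exp (((-t : ℝ) : ℂ) * I) := fun t => by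
    rw [← Complex.exp_conj, map_mul, conj_ofReal, conj_I, ofReal_neg]; ring_nf
  -- `(z - c) conj n = w · e^{-iφ₀/2}` and `(z - c) conj n' = w · e^{iφ₀/2}`, `w = (z - c) conj b`
  have hbn : b * conj n = exp (((-(φ₀ / 2) : ℝ) : ℂ) * I) := by
    have h1 : b * conj n = conj u * exp (((φ₀ / 2 : ℝ) : ℂ) * I) := by
      simp only [hb, hu, map_mul, conj_conj]; ring
    rw [h1, hue, hconj_exp, ← Complex.exp_add, ← add_mul, ← ofReal_add]
    congr 2; push_cast; ring
  have hbn' : b * conj n' = exp (((φ₀ / 2 : ℝ) : ℂ) * I) := by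
    simp only [hb]; rw [mul_right_comm, hnn', one_mul]
  have hkey : ∀ z : ℂ, (z - c) * conj n = ((z - c) * conj b) * exp (((-(φ₀ / 2) : ℝ) : ℂ) * I) ∧
      (z - c) * conj n' = ((z - c) * conj b) * exp (((φ₀ / 2 : ℝ) : ℂ) * I) := fun z => by
    constructor
    · rw [← hbn, mul_assoc, ← mul_assoc (conj b), hbb, one_mul]
    · rw [← hbn', mul_assoc, ← mul_assoc (conj b), hbb, one_mul]
  -- `ψ = arg b`: `e^{-iψ} = conj b`
  have hψ : exp (-((arg b : ℝ) : ℂ) * I) = conj b := by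
    have := norm_mul_exp_arg_mul_I b
    rw [hb1, ofReal_one, one_mul] at this
    rw [← this, hconj_exp, this, ofReal_neg, neg_mul]
  have hw0 : ∀ z : ℂ, (z - c) * conj b = 0 ↔ z = c := fun z => by
    rw [mul_eq_zero, sub_eq_zero, or_iff_left]
    exact fun h => by simp [h] at hbb
  refine ⟨arg b, θ, ?_, ?_, ?_, ?_⟩
  · have : |φ₀| / Real.pi ≤ 2 / 3 := by rw [div_le_iff₀ Real.pi_pos]; linarith
    rw [hθ]; linarith
  · rw [hθ, sub_lt_self_iff]; positivity
  · ext z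
    simp only [mem_inter_iff, mem_setOf_eq, ne_eq]
    rw [(hkey z).1, (hkey z).2, hθπ, hψ, ← hw0 z]
    rcases lt_or_gt_of_ne hφ₀0 with hneg | hpos
    · have hα' : α = -(φ₀ / 2) := by rw [hα, abs_of_neg hneg]; ring
      rw [show (φ₀ / 2 : ℝ) = -α by rw [hα']; ring, show (-(-α) : ℝ) = α by ring]
      exact and_comm.trans (wedge_inter_iff hα0 hαπ _)
    · have hα' : α = φ₀ / 2 := by rw [hα, abs_of_pos hpos]
      rw [← hα']
      exact wedge_inter_iff hα0 hαπ _
  · ext z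
    simp only [mem_union, mem_setOf_eq, ne_eq]
    rw [(hkey z).1, (hkey z).2, hθπ', hψ, ← hw0 z]
    rcases lt_or_gt_of_ne hφ₀0 with hneg | hpos
    · have hα' : α = -(φ₀ / 2) := by rw [hα, abs_of_neg hneg]; ring
      rw [show (φ₀ / 2 : ℝ) = -α by rw [hα']; ring, show (-(-α) : ℝ) = α by ring]
      exact or_comm.trans (wedge_union_iff hα0 hαπ _)
    · have hα' : α = φ₀ / 2 := by rw [hα, abs_of_pos hpos]
      rw [← hα']
      exact wedge_union_iff hα0 hαπ _

/-! ### 3. The six zigzag normals -/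

/-- **Mutual angles of the six zigzag normals**: two of them that are neither equal nor opposite
make an angle of `60°` or `120°`, in particular `re(n conj n') ≥ -1/2`. [folklore] -/
theorem innerNormal_re_mul_conj (k k' : Fin 6) (h1 : innerNormal k' ≠ innerNormal k)
    (h2 : innerNormal k' ≠ -innerNormal k) :
    -(1 / 2 : ℝ) ≤ (innerNormal k * conj (innerNormal k')).re := by
  have h3 : Real.sqrt 3 * Real.sqrt 3 = 3 := Real.mul_self_sqrt (by norm_num)
  fin_cases k <;> fin_cases k' <;> simp [innerNormal_eq, Complex.ext_iff] at h1 h2 ⊢ <;>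
    nlinarith [h3, Real.sqrt_nonneg 3]

/-! ### 4. Registered form -/

/-- **Registered helper `transport_halfPlanesWedge`** (∀-closed form of `halfPlanes_eq_wedge`;
sub-goal F3 of stub `transportRigidity` (E), crux stmt-CriticalPhenomena-14004, line
`polygon-parity-squeeze`). [folklore] -/
theorem transport_halfPlanesWedge : ∀ (n n' c : ℂ), ‖n‖ = 1 → ‖n'‖ = 1 → n' ≠ n → n' ≠ -n → -(1 / 2 : ℝ) ≤ (n * (starRingEnd ℂ) n').re → ∃ ψ θ : ℝ, 1 / 3 ≤ θ ∧ θ < 1 ∧ {w : ℂ | 0 < ((w - c) * (starRingEnd ℂ) n).re} ∩ {w : ℂ | 0 < ((w - c) * (starRingEnd ℂ) n').re} = {z : ℂ | z ≠ c ∧ |Complex.arg ((z - c) * Complex.exp (-(ψ : ℂ) * Complex.I))| < θ * Real.pi / 2} ∧ {w : ℂ | 0 < ((w - c) * (starRingEnd ℂ) n).re} ∪ {w : ℂ | 0 < ((w - c) * (starRingEnd ℂ) n').re} = {z : ℂ | z ≠ c ∧ |Complex.arg ((z - c) * Complex.exp (-(ψ : ℂ) * Complex.I))| < (2 - θ) *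 Real.pi / 2} :=
  fun _n _n' c hn hn' hne hne' hcos => halfPlanes_eq_wedge hn hn' hne hne' hcos c

end Transport

end Summit.CriticalPhenomena.SAWScalingLimit.Theorems.PolygonParitySqueeze
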